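import Summits.HodgeConjecture.HodgeConjecture.Theorems.R90S6ConstantTermTransport   -- ★ (B2a) p864210: §1 `coeff_toVector_conj`, §3 (T.2) `integral_comp_frame_mul_eq_integral_map`, `map_frame_apply_setOf_mem`, `isMulLeftInvariant_map_frame`, `map_mem_normalizer_of_frame`; brings ★ (B1) fibre lemmas `integral_finsupp_mk_mul_eq_mul_sum_filter`, `heckeAlgebra.toVector`, Mathlib product ∕ Haar measures
import Summits.HodgeConjecture.HodgeConjecture.Theorems.R90S6CartierGL               -- TB2a FILE 1a: `integral_coeff_toVector_mul_eq_gl` (Cartier on `GL_n(F)`); brings ★ `SatakeTransformGL` (`iwasawaExp`, `satakeWeight`, `satakeTransform`, `glInt`, `upperUnitriangular`)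
import HarnessLib

/-!
# R90 · S6 «Ch. 14.1–14.5 stable trace formula» — CARD TB2a (rows E1.4.4.2.3 ∕ TB2d), FILE 1b: TWISTED CONSTANT-TERM TRANSPORT AT THE `K̃ × Ñ` LEVEL
# `∫_{K̃×Ñ} T[K̃](E(k (δ′ n) ε(k)⁻¹)) d(κ⊗μ_Ñ) = κ(K̃) · μ_Ñ(Ñ ∩ K̃) · (q^{−⟨ν,e(Eδ′)⟩})⁻¹ · 𝒮(T)_{e(E δ′)}` (`Theorems/R90S6TwistedConstantTermTransport.lean`)

Dealer R90-C14-plan (g2), CARD TB2a 2026-09-05T01:56:15Z («TWISTED CONSTANT-TERM TRANSPORT at ε-regular `δ` with HYPERBOLIC norm — the ε-twin of the ★ B2a chain: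
twisted descent `G̃ → B̃ → M̃` by Iwasawa unfolding exactly as B2a FILE 1»), «=» 02:01:52Z (Jacobian = `D_G(N(δ))` carried as a hypothesis letter; its computation is p06 (g2)'s
TJ1) and the CUT 02:10:22Z («FILE 1a `Theorems/R90S6CartierGL.lean` = the `GL_n` Cartier API alone; FILE 1b `Theorems/R90S6TwistedConstantTermTransport.lean` = twisted
`K̃`-invariance + (tT.1) + the frame, importing FILE 1a + ★ B2a»).  The 400-line rule puts the quotient-measure descent `G̃ ⧸ G̃_{δε} → M̃ ⧸ G̃_{δε} × K̃ × Ñ` (hypothesis-driven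
in the `Ñ`-twist `J`) in the companion FILE 1c `Theorems/R90S6TwistedTorusDescent.lean` (independent of this file); FILE 2 composes 1b + 1c with TJ1's `J = D_G(N(δ))` and
p10 (g2)'s TL4 apartment dictionary.

THE MATHEMATICS [Rogawski1990, §4.10 pp. 57–59; §4.13 p. 70; CartierCorvallis1979 §IV (4.2)].  For `δ′ ∈ M̃` (the ε-stable diagonal torus of `G̃ = GL₃(E_w)`) the
ε-twisted orbital integral `Φ_ε(δ, φ) = ∫ φ(x δ ε(x)⁻¹)` (the tree's `descEpsConj`, ★ `Rogawski1990.Ch4Sec10`) unfolds along `G̃ = K̃ Ñ M̃`: writing `x = k n m`,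
`x δ ε(x)⁻¹ = k · n δ′ ε(n)⁻¹ · ε(k)⁻¹` with `δ′ = m δ ε(m)⁻¹ ∈ M̃`; after the change of variables `n ↦ δ′⁻¹ (n δ′ ε(n)⁻¹)` on `Ñ` (modulus `J = D_G(N(δ))`-factor of the
twisted Weyl integration formula, p. 59 — FILE 1c's letter `hJac`, TJ1's value) the integrand is `φ(k (δ′ n) ε(k)⁻¹)`.  Since `ε(K̃) = K̃` and `φ = T[K̃]` is bi-`K̃`-invariant,
`φ(k g ε(k)⁻¹) = φ(g)` (§1), so the `dk` integration is the mass `κ(K̃)` (§2, (tT.1)), and the remaining `∫_Ñ T[K̃](δ′ n) dn` is Cartier's constant term on `GL_n` (FILE 1a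
`integral_coeff_toVector_mul_eq_gl`: `= μ_Ñ(Ñ ∩ K̃) · (q^{−⟨ν,e(δ′)⟩})⁻¹ · 𝒮(T)_{e(δ′)}`) — read through a Borel-compatible frame `E : G ≃ₜ* GL_n(F)` and its restriction `EN` to
the unipotent radicals (§3, ★ B2a §3), laws as binders exactly as ★ B2a FILE 1.

* §1 (any group, any `k`) `mk_mul_mul_inv_mem_orbit` · **`coeff_toVector_mul_mul_inv`** (`T[K](a g b⁻¹) = T[K](g)` for `a, b ∈ K`) · **`coeff_toVector_twistedConj`**
  (`T[K](a g ε(a)⁻¹) = T[K](g)` for `a ∈ K`, `ε(K) ⊆ K` — the Hecke form of ★ J1′ `twistedConj_mem_iff_of_biInvariant`) · `coeff_toVector_map_twistedConj` (through a hom `E`).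
* §2 (tT.1) **`integral_prod_twistedConj_eq_mul`** (any `f` with `f(a g ε(a)⁻¹) = f g` for `a ∈ K₃`: `∫_{K₃×N} f(k (t n) ε(k)⁻¹) d(κ⊗μ_N) = κ(K₃) · ∫_N f(t n) dμ_N`, Mathlib
  `integral_fun_snd`) and its Hecke form **`integral_prod_coeff_toVector_twistedConj_eq_mul`**.
* §3 THROUGH THE FRAME (`hN` N-law, `hEK` K-law, `EN` + `hEN` restriction, `hK : GL_n(𝒪)` measurable): **`integral_coeff_toVector_frame_mul_eq_gl`**
  (`∫_N T[K](E(t n)) dμ_N = μ_N(N ∩ K₃) · (q^{−⟨ν,e(Et)⟩})⁻¹ · 𝒮(T)_{e(E t)}`), the ε-TWISTED HEAD **`integral_prod_coeff_toVector_twistedConj_frame_eq_gl`**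
  (`∫_{K₃×N} T[K](E(k (t n) ε(k)⁻¹)) = κ(K₃) · μ_N(N ∩ K₃) · (q^{−⟨ν,e(Et)⟩})⁻¹ · 𝒮(T)_{e(E t)}`) and its untwisted (`ε = id`) companion `integral_prod_coeff_toVector_conj_frame_eq_gl`.

Cell `hodgecm-mathlib`, crux H413 (`stmt-HodgeConjecture-24833`), route of record `HCCMUnconditional`; programme R90-TF (brief `director/R90-BRIEF.v2.md` 1f40d54518340a35),
section S6 (base `R90-C14`), seat R90-C14-p01 (g2).  Lane `--kind proof --supports stmt-HodgeConjecture-24833 --as helper`; THEOREMS ONLY (no definition, no instance, no notation,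
no named fact, no kit, no `sorry`); imports ★ (B2a) `Theorems/R90S6ConstantTermTransport` + TB2a FILE 1a `Theorems/R90S6CartierGL` + HarnessLib; never `Lines/`.
HONEST LABEL: unfolding bookkeeping at the `K̃ × Ñ` level, count-neutral until the (TB2d) value theorem consumes it; the ε-twisted torus descent (FILE 1c), its Jacobian (TJ1) and
the `M̃`-fibre sum (FILE 2) are NOT here; proves no printed global statement, discharges no citation; HC_CM is proved only modulo the 7 printed citations (2 remaining named inputs:
hLiu418 = stmt-HodgeConjecture-24832, h413 = stmt-HodgeConjecture-24833) until rung 0 closes.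

## Tree search
★ `Rogawski1990.Ch4Sec10` (`descEpsConj`, `epsOrbitalIntegral` — currency only); ★ `R90S6TwistedOrbitalIndicatorCount` :71 `twistedConj_mem_iff_of_biInvariant` (set form of §1);
★ `R90S6ConstantTermTransport` §1 (`coeff_toVector_conj`, the untwisted letter) and §3 (`integral_comp_frame_mul_eq_integral_map`, `map_frame_apply_setOf_mem`,
`isMulLeftInvariant_map_frame`, `map_mem_normalizer_of_frame` — reused verbatim in §3); FILE 1a `R90S6CartierGL` (`integral_coeff_toVector_mul_eq_gl`).  Dedup:
`rg "twistedConj_eq_mul|coeff_toVector_mul_mul_inv|_frame_mul_eq_gl"` over `lean/` — no hit.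

## References
* [Rogawski1990] J. D. Rogawski, *Automorphic Representations of Unitary Groups in Three Variables*, Ann. of Math. Stud. 123 (1990): §4.10 pp. 57–59 (`Φ_ε(δ,φ)`, Prop. 4.10.1,
  proof of Prop. 4.10.2: «`Tr(π̃(φ)π̃(ε)) = ∫ D_G(N(δ)) Φ_ε(δ,φ) χ(N(δ)) dδ`»); §4.13 p. 70 («`dg = dk dm du`»); §4.9 (4.9.2) p. 55.
* [CartierCorvallis1979] P. Cartier, *Representations of 𝔭-adic groups: a survey*, PSPM 33.1 (1979): §IV (4.2) p. 146 (`(Sf)(m) = δ(m)^{1∕2} ∫_N f(mn) dn`), Thm. 4.1.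
* [Kottwitz1986BaseChangeUnits] R. Kottwitz, *Base change for unit elements of Hecke algebras*, Compositio Math. 60 (1986): §1 pp. 239–242 (twisted orbital integrals of
  bi-`K`-invariant functions).
* [DeitmarEchterhoff2014] A. Deitmar, S. Echterhoff, *Principles of Harmonic Analysis*, 2nd ed. (2014): Thm. 1.5.3.
-/

set_option autoImplicit false
-- the mandated namespace repeats the single-problem summit's segment (`HodgeConjecture.HodgeConjecture`)
set_option linter.dupNamespace false

noncomputable section

open MeasureTheory Measure Set Function
open scoped ENNReal NNReal Pointwise
open MulAction ValuativeRel Finset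
open Literature.NumberTheory.Automorphic Literature.NumberTheory.Automorphic.heckeAlgebra

namespace Summit.HodgeConjecture.HodgeConjecture.R90.S6

/-! ## §1 `T[K]` is bi-`K`-invariant, hence invariant under the twisted conjugation `g ↦ a g ε(a)⁻¹` (`a ∈ K`, `ε(K) ⊆ K`) -/

section TwistedConj

variable {k G : Type*} [CommRing k] [Group G] (K : Subgroup G)

/-- For `a, b ∈ K`, the coset of `a g b⁻¹` lies in the `K`-orbit of the coset of `g` in `G ⧸ K` (it is `a • gK`). [cite: CartierCorvallis1979, §IV Thm. 4.1] -/
theorem mk_mul_mul_inv_mem_orbit {a b : G} (ha : a ∈ K) (hb : b ∈ K) (g : G) :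
    ((a * g * b⁻¹ : G) : G ⧸ K) ∈ MulAction.orbit K (g : G ⧸ K) := by
  have h1 : ((a * g * b⁻¹ : G) : G ⧸ K) = ((a * g : G) : G ⧸ K) :=
    QuotientGroup.eq.2 (by rw [show (a * g * b⁻¹)⁻¹ * (a * g) = b by group]; exact hb)
  rw [h1]
  exact MulAction.mem_orbit_iff.2 ⟨⟨a, ha⟩, rfl⟩

/-- **`T[K](a g b⁻¹) = T[K](g)` for `a, b ∈ K`**: the coset function of a Hecke-algebra element is bi-`K`-invariant (left `K`-invariance of `T[K]`, ★ `ofMulAction_toVector`,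
along the `K`-orbit `mk_mul_mul_inv_mem_orbit`, ★ `coeff_eq_of_mem_orbit`). [cite: CartierCorvallis1979, §IV Thm. 4.1] -/
theorem coeff_toVector_mul_mul_inv (T : heckeAlgebra k G K) {a b : G} (ha : a ∈ K) (hb : b ∈ K) (g : G) :
    (toVector K T).coeff ((a * g * b⁻¹ : G) : G ⧸ K) = (toVector K T).coeff (g : G ⧸ K) :=
  coeff_eq_of_mem_orbit K (fun _ hc => ofMulAction_toVector K T hc) (mk_mul_mul_inv_mem_orbit K ha hb g)

/-- **TWISTED CONJUGATION INVARIANCE `T[K](a g ε(a)⁻¹) = T[K](g)`** for `a ∈ K` and any map `ε : G → G` with `ε(K) ⊆ K` — the Hecke form of ★ J1′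
`twistedConj_mem_iff_of_biInvariant`. [cite: Kottwitz1986BaseChangeUnits, §1 p. 239] [cite: Rogawski1990, §4.10 p. 57] -/
theorem coeff_toVector_twistedConj (T : heckeAlgebra k G K) (ε : G → G) (hεK : ∀ a ∈ K, ε a ∈ K) {a : G} (ha : a ∈ K) (g : G) :
    (toVector K T).coeff ((a * g * (ε a)⁻¹ : G) : G ⧸ K) = (toVector K T).coeff (g : G ⧸ K) :=
  coeff_toVector_mul_mul_inv K T ha (hεK a ha) g

/-- **Through a frame**: for a monoid-hom-like `E : G₁ → G` with `E(K₁) ⊆ K`, a map `ε : G₁ → G₁` with `ε(K₁) ⊆ K₁` and `a ∈ K₁`, `T[K](E(a g ε(a)⁻¹)) = T[K](E g)`.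
[cite: Kottwitz1986BaseChangeUnits, §1 p. 239] -/
theorem coeff_toVector_map_twistedConj {G₁ F : Type*} [Group G₁] [FunLike F G₁ G] [MonoidHomClass F G₁ G] (E : F) {K₁ : Subgroup G₁}
    (hEK : ∀ a ∈ K₁, E a ∈ K) (T : heckeAlgebra k G K) (ε : G₁ → G₁) (hεK : ∀ a ∈ K₁, ε a ∈ K₁) {a : G₁} (ha : a ∈ K₁) (g : G₁) :
    (toVector K T).coeff ((E (a * g * (ε a)⁻¹) : G) : G ⧸ K) = (toVector K T).coeff ((E g : G) : G ⧸ K) := by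
  rw [map_mul, map_mul, map_inv]
  exact coeff_toVector_mul_mul_inv K T (hEK a ha) (hEK _ (hεK a ha)) (E g)

end TwistedConj

/-! ## §2 (tT.1): `∫_{K₃×N} f(k (t n) ε(k)⁻¹) d(κ⊗μ_N) = κ(K₃) · ∫_N f(t n) dμ_N` for `f` invariant under twisted `K₃`-conjugation -/

section TwistedFubini

variable {G : Type*} [Group G] (K₃ N : Subgroup G) [MeasurableSpace ↥K₃] [MeasurableSpace ↥N]
  (κ : Measure ↥K₃) (μN : Measure ↥N) [SFinite κ] [SFinite μN]

/-- **(tT.1), function form**: if `f : G → ℂ` satisfies `f(a g ε(a)⁻¹) = f g` for all `a ∈ K₃`, then for every `t ∈ G`,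
`∫_{K₃×N} f(k (t n) ε(k)⁻¹) d(κ ⊗ μ_N) = κ(K₃) · ∫_N f(t n) dμ_N` (the integrand does not depend on `k`; Mathlib `integral_fun_snd`) — the «`dk`» integration of the twisted
descent. [cite: Rogawski1990, §4.10 p. 57; §4.13 p. 70] [cite: Kottwitz1986BaseChangeUnits, §1 p. 240] -/
theorem integral_prod_twistedConj_eq_mul (ε : G → G) (f : G → ℂ) (hf : ∀ a ∈ K₃, ∀ g : G, f (a * g * (ε a)⁻¹) = f g) (t : G) :
    ∫ p : ↥K₃ × ↥N, f ((p.1 : G) * (t * (p.2 : G)) * (ε (p.1 : G))⁻¹) ∂(κ.prod μN) = (κ Set.univ).toReal * ∫ n : ↥N, f (t * (n : G)) ∂μN := by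
  have h : (fun p : ↥K₃ × ↥N => f ((p.1 : G) * (t * (p.2 : G)) * (ε (p.1 : G))⁻¹)) = fun p : ↥K₃ × ↥N => f (t * (p.2 : G)) := by
    funext p
    exact hf p.1 p.1.2 _
  rw [h]
  have key := integral_fun_snd (μ := κ) (ν := μN) (fun n : ↥N => f (t * (n : G)))
  rw [key, Complex.real_smul]
  rfl

/-- **(tT.1), HECKE FORM**: for a monoid-hom-like frame `E : G → G′` with `E(K₃) ⊆ K₀`, a map `ε : G → G` with `ε(K₃) ⊆ K₃` and `T ∈ ℋ(G′, K₀)`,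
`∫_{K₃×N} T[K₀](E(k (t n) ε(k)⁻¹)) d(κ ⊗ μ_N) = κ(K₃) · ∫_N T[K₀](E(t n)) dμ_N`. [cite: Rogawski1990, §4.10 p. 57; §4.13 p. 70] [cite: CartierCorvallis1979, §IV (4.2) p. 146] -/
theorem integral_prod_coeff_toVector_twistedConj_eq_mul {G' F : Type*} [Group G'] [FunLike F G G'] [MonoidHomClass F G G'] (E : F)
    (K₀ : Subgroup G') (hEK : ∀ a ∈ K₃, E a ∈ K₀) (ε : G → G) (hεK : ∀ a ∈ K₃, ε a ∈ K₃) (T : heckeAlgebra ℂ G' K₀) (t : G) :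
    ∫ p : ↥K₃ × ↥N, (toVector K₀ T).coeff ((E ((p.1 : G) * (t * (p.2 : G)) * (ε (p.1 : G))⁻¹) : G') : G' ⧸ K₀) ∂(κ.prod μN) =
      (κ Set.univ).toReal * ∫ n : ↥N, (toVector K₀ T).coeff ((E (t * (n : G)) : G') : G' ⧸ K₀) ∂μN :=
  integral_prod_twistedConj_eq_mul K₃ N κ μN ε (fun g => (toVector K₀ T).coeff ((E g : G') : G' ⧸ K₀))
    (fun _ ha g => coeff_toVector_map_twistedConj K₀ E hEK T ε hεK ha g) t

end TwistedFubini

/-! ## §3 Through a Borel-compatible frame `E : G ≃ₜ* GL_n(F)`: Cartier's value and the ε-TWISTED HEAD -/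

section TwistedFrame

variable {F : Type*} [Field F] [ValuativeRel F] {n : ℕ} [IsDiscreteValuationRing 𝒪[F]] {ϖ : F} (hϖ : IsUniformizingElement ϖ) [Finite 𝓀[F]]
  [TopologicalSpace F] [IsTopologicalRing F] [MeasurableSpace (GL (Fin n) F)] [BorelSpace (GL (Fin n) F)]
  {G : Type*} [Group G] [TopologicalSpace G] [IsTopologicalGroup G] [MeasurableSpace G] [BorelSpace G]
  (E : G ≃ₜ* GL (Fin n) F) {N K₃ : Subgroup G}
  (hN : ∀ g : G, g ∈ N ↔ E g ∈ upperUnitriangular (Fin n) F)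
  (hEK : ∀ g : G, E g ∈ glInt n F ↔ g ∈ K₃)
  (EN : ↥N ≃ₜ* ↥(upperUnitriangular (Fin n) F))
  (hEN : ∀ u : ↥N, ((EN u : ↥(upperUnitriangular (Fin n) F)) : GL (Fin n) F) = E (u : G))
  (μN : Measure ↥N) [μN.IsMulLeftInvariant]
  (hK : MeasurableSet (glInt n F : Set (GL (Fin n) F)))
include hϖ hN hEK hEN hK

/-- **CARTIER THROUGH THE FRAME, `N`-form (`GL_n`)**: for a frame `E : G ≃ₜ* GL_n(F)` with the N-law (`g ∈ N ↔ E g ∈ U`) and the K-law (`E g ∈ GL_n(𝒪) ↔ g ∈ K₃`), any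
restriction `EN` of `E` to `N → U`, `T ∈ ℋ(GL_n(F), GL_n(𝒪))`, `t ∈ N_G(N)`, `GL_n(𝒪)` measurable, and a left-invariant `μ_N` on `↥N` with `μ_N(N ∩ K₃) < ∞`:
`∫_N T[K](E(t n)) dμ_N = μ_N(N ∩ K₃) · (q^{−⟨ν,e(E t)⟩})⁻¹ · 𝒮(T)_{e(E t)}` — ★ (B2a) (T.2) + §3 for the transported measure `EN_* μ_N`.
[cite: CartierCorvallis1979, §IV (4.2) p. 146] [cite: Rogawski1990, §4.10 p. 57; §4.9 (4.9.2) p. 55] [cite: DeitmarEchterhoff2014, Thm. 1.5.3] -/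
theorem integral_coeff_toVector_frame_mul_eq_gl (T : heckeAlgebra ℂ (GL (Fin n) F) (glInt n F)) {t : G} (ht : t ∈ Subgroup.normalizer (N : Set G))
    (hfin : μN {u : ↥N | (u : G) ∈ K₃} ≠ ∞) :
    ∫ u : ↥N, (toVector (glInt n F) T).coeff ((E (t * (u : G)) : GL (Fin n) F) : GL (Fin n) F ⧸ glInt n F) ∂μN =
      (μN {u : ↥N | (u : G) ∈ K₃}).toReal *
        ((satakeWeight (Nat.card 𝓀[F] : ℂ) (iwasawaExp hϖ (E t)))⁻¹ * (satakeTransform hϖ T).coeff (iwasawaExp hϖ (E t))) := by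
  haveI : (Measure.map EN μN).IsMulLeftInvariant := isMulLeftInvariant_map_frame EN μN
  have hN₀ : MeasurableSet {u : ↥(upperUnitriangular (Fin n) F) | (u : GL (Fin n) F) ∈ glInt n F} := measurable_subtype_coe hK
  have hmass := map_frame_apply_setOf_mem E EN hEN μN hEK hK
  have hfin' : Measure.map EN μN {u : ↥(upperUnitriangular (Fin n) F) | (u : GL (Fin n) F) ∈ glInt n F} ≠ ∞ := by
    rw [hmass]; exact hfin
  rw [integral_comp_frame_mul_eq_integral_map E EN hEN μN
      (fun g => (toVector (glInt n F) T).coeff (g : GL (Fin n) F ⧸ glInt n F)) t,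
    integral_coeff_toVector_mul_eq_gl hϖ (Measure.map EN μN) T (map_mem_normalizer_of_frame E hN ht) hN₀ hfin', hmass]

variable [MeasurableSpace ↥K₃] (κ : Measure ↥K₃) [SFinite κ] [SFinite μN]

/-- **CARD TB2a HEAD — THE ε-TWISTED CONSTANT-TERM TRANSPORT AT THE `K₃ × N` LEVEL**: under the hypotheses of `integral_coeff_toVector_frame_mul_eq_gl`, for any s-finite `κ`
on `↥K₃` and any map `ε : G → G` with `ε(K₃) ⊆ K₃` (e.g. the base-change involution `ε_v`, which preserves `K̃ = GL₃(𝒪_{E_w})`),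
`∫_{K₃×N} T[K](E(k (t n) ε(k)⁻¹)) d(κ ⊗ μ_N) = κ(K₃) · (μ_N(N ∩ K₃) · (q^{−⟨ν,e(E t)⟩})⁻¹ · 𝒮(T)_{e(E t)})` — (tT.1) ∘ (T.2) ∘ Cartier on `GL_n`: the `K̃ × Ñ` integral of the
twisted Iwasawa unfolding of `Φ_ε(δ, T[K̃] ∘ E)` at `t = δ′ ∈ M̃`, read as a `GL_n` Satake coefficient.
[cite: Rogawski1990, §4.10 pp. 57–59; §4.13 p. 70] [cite: CartierCorvallis1979, §IV (4.2) p. 146] [cite: Kottwitz1986BaseChangeUnits, §1 pp. 239–242] -/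
theorem integral_prod_coeff_toVector_twistedConj_frame_eq_gl (ε : G → G) (hεK : ∀ a ∈ K₃, ε a ∈ K₃)
    (T : heckeAlgebra ℂ (GL (Fin n) F) (glInt n F)) {t : G} (ht : t ∈ Subgroup.normalizer (N : Set G)) (hfin : μN {u : ↥N | (u : G) ∈ K₃} ≠ ∞) :
    ∫ p : ↥K₃ × ↥N, (toVector (glInt n F) T).coeff
        ((E ((p.1 : G) * (t * (p.2 : G)) * (ε (p.1 : G))⁻¹) : GL (Fin n) F) : GL (Fin n) F ⧸ glInt n F) ∂(κ.prod μN) =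
      (κ Set.univ).toReal * ((μN {u : ↥N | (u : G) ∈ K₃}).toReal *
        ((satakeWeight (Nat.card 𝓀[F] : ℂ) (iwasawaExp hϖ (E t)))⁻¹ * (satakeTransform hϖ T).coeff (iwasawaExp hϖ (E t)))) := by
  rw [integral_prod_coeff_toVector_twistedConj_eq_mul K₃ N κ μN E (glInt n F) (fun a ha => (hEK a).2 ha) ε hεK T t,
    integral_coeff_toVector_frame_mul_eq_gl hϖ E hN hEK EN hEN μN hK T ht hfin]

/-- **Untwisted companion (`ε = id`, split places)**: `∫_{K₃×N} T[K](E(k (t n) k⁻¹)) d(κ ⊗ μ_N) = κ(K₃) · (μ_N(N ∩ K₃) · (q^{−⟨ν,e(E t)⟩})⁻¹ · 𝒮(T)_{e(E t)})` — the `GL_n`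
twin of ★ (B2a) `integral_prod_coeff_toVector_frame_eq`. [cite: Rogawski1990, §4.9 (4.9.2) p. 55; §4.13 p. 70] [cite: CartierCorvallis1979, §IV (4.2) p. 146] -/
theorem integral_prod_coeff_toVector_conj_frame_eq_gl (T : heckeAlgebra ℂ (GL (Fin n) F) (glInt n F)) {t : G} (ht : t ∈ Subgroup.normalizer (N : Set G))
    (hfin : μN {u : ↥N | (u : G) ∈ K₃} ≠ ∞) :
    ∫ p : ↥K₃ × ↥N, (toVector (glInt n F) T).coeff
        ((E ((p.1 : G) * (t * (p.2 : G)) * (p.1 : G)⁻¹) : GL (Fin n) F) : GL (Fin n) F ⧸ glInt n F) ∂(κ.prod μN) =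
      (κ Set.univ).toReal * ((μN {u : ↥N | (u : G) ∈ K₃}).toReal *
        ((satakeWeight (Nat.card 𝓀[F] : ℂ) (iwasawaExp hϖ (E t)))⁻¹ * (satakeTransform hϖ T).coeff (iwasawaExp hϖ (E t)))) :=
  integral_prod_coeff_toVector_twistedConj_frame_eq_gl hϖ E hN hEK EN hEN μN hK κ _root_.id (fun _ ha => ha) T ht hfin

end TwistedFrame

end Summit.HodgeConjecture.HodgeConjecture.R90.S6

end
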